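import Mathlib
import Literature.Computability.AlgebraicComplexity.BigCwLaserSupport

/-!
# The typed free diagonal of level triples (stub `stub_typedFreeDiagonal`)

Route `MatrixMultiplication/AutomaticSTPPDesigns`, crux `stmt-MatrixMultiplication-7357`
(`AutomaticDesignBelowFourFifths`), line `digit-sum-sliced-laser`; support lemma (stub 1 of the
skeleton `Cruxes/AutomaticDesignBelowFourFifths/Lines/digit_sum_sliced_laser.lean`).

This is the tree theorem `Literature.Computability.AlgebraicComplexity.exists_free_bigCw_diagonal a b`
(`BigCwLaserSupport.lean`; Bürgisser–Clausen–Shokrollahi 1997, Thm. 15.41, proof step (B), p. 381,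
for the tensor `CW_q` of p. 384) RE-EXPORTED WITH THE TYPES of the three level sequences: for all
`a, b` there is a family `Δ` of level triples `(I, J, L) ∈ ({0,1,2}^{3a+3b})³` with `I + J + L ≡ 2`
pointwise, `a` positions of each pattern `(1,1,·), (0,1,·), (1,0,·)`, all three sequences of type
`(#0, #1, #2) = (a+2b, 2a, b)`, which is FREE (`I_δ + J_δ' + L_δ'' ≡ 2 ⇒ δ = δ' = δ''`), with
`binom(3a+3b; a+2b, 2a, b) · rothNumberNat(3f) ≤ 288 f |Δ|`, `f = C(2a,a) C(a+2b,a) C(2b,b)`.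

The proof is the tree's, verbatim: the type-restricted support
`Φ = {(I,J,L) | I+J+L ≡ 2, all three of type (a+2b, 2a, b)}` has fibres of size `≤ f`
(`card_filter_fibre_le`, via `laserPatternCounts`) and `|Φ| ≥ binom(3a+3b; a,a,a,b,b,b) = binom · f`
(`le_card_laserSupport`, `multinomial_six_eq`); it is `2`-tight, so the hashing theorem
`BCS1997_thm1539_free` (BCS Thm. 15.39) with a Bertrand prime `6f < M ≤ 12f` and the Salem–Spencer
diagonal `exists_zeroSum_diagonal` gives a free diagonal `Δ ⊆ Φ` of the stated size; the types of the
members of `Δ` are read off from `Δ ⊆ Φ` (the one conjunct the tree export omits).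
-/

-- single-conjunct summit: the mandated namespace repeats `MatrixMultiplication`.
set_option linter.dupNamespace false

noncomputable section

open Finset
open scoped BigOperators

namespace Summit.MatrixMultiplication.MatrixMultiplication.Theorems

namespace AutomaticDesignBelowFourFifths

open Literature.Computability.AlgebraicComplexity

/-- **Typed free diagonal of level triples** (= `exists_free_bigCw_diagonal a b` with the nine letter
counts of `Φ` kept in the export; BCS 1997 Thm. 15.41, proof step (B): a diagonal `Δ ⊆ Φ` with
`|Δ| ≥ C · min binom(N, μ)`, via Thm. 15.39 applied to the `2`-tight set `Φ`): for all `a, b` there is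
a family `Δ` of level triples `(I, J, L) ∈ ({0,1,2}^{3a+3b})³` with `I + J + L ≡ 2` pointwise, `a`
positions of each pattern `(1,1,·), (0,1,·), (1,0,·)`, all three sequences of type
`(#0, #1, #2) = (a+2b, 2a, b)`, which is a free diagonal, with
`binom(3a+3b; a+2b, 2a, b) · rothNumberNat(3f) ≤ 288 f |Δ|`, `f = C(2a,a) C(a+2b,a) C(2b,b)`
(hashing theorem with a Bertrand prime `6f < M ≤ 12f` and the Salem–Spencer diagonal of size
`≥ rothNumberNat(M/2)`). [cite: BurgisserClausenShokrollahi1997, Thm. 15.41 (proof, p. 381) and p. 384] -/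
theorem stub_typedFreeDiagonal :
    ∀ a b : ℕ,
    ∃ Δ : Finset ((Fin (3 * a + 3 * b) → Fin 3) × (Fin (3 * a + 3 * b) → Fin 3) ×
        (Fin (3 * a + 3 * b) → Fin 3)),
      (∀ δ ∈ Δ, ∀ t, (δ.1 t : ℕ) + δ.2.1 t + δ.2.2 t = 2) ∧
      (∀ δ ∈ Δ, (univ.filter fun t => δ.1 t = 1 ∧ δ.2.1 t = 1).card = a ∧
        (univ.filter fun t => δ.1 t = 0 ∧ δ.2.1 t = 1).card = a ∧
        (univ.filter fun t => δ.1 t = 1 ∧ δ.2.1 t = 0).card = a) ∧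
      (∀ δ ∈ Δ,
        (letterCount δ.1 0 = a + 2 * b ∧ letterCount δ.1 1 = 2 * a ∧ letterCount δ.1 2 = b) ∧
        (letterCount δ.2.1 0 = a + 2 * b ∧ letterCount δ.2.1 1 = 2 * a ∧
          letterCount δ.2.1 2 = b) ∧
        (letterCount δ.2.2 0 = a + 2 * b ∧ letterCount δ.2.2 1 = 2 * a ∧
          letterCount δ.2.2 2 = b)) ∧
      (∀ δ ∈ Δ, ∀ δ' ∈ Δ, ∀ δ'' ∈ Δ,
        (∀ t, (δ.1 t : ℕ) + δ'.2.1 t + δ''.2.2 t = 2) → δ = δ' ∧ δ' = δ'') ∧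
      Nat.multinomial univ ![a + 2 * b, 2 * a, b] *
          rothNumberNat (3 * ((2 * a).choose a * ((a + 2 * b).choose a * (2 * b).choose b))) ≤
        288 * ((2 * a).choose a * ((a + 2 * b).choose a * (2 * b).choose b)) * Δ.card := by
  intro a b
  classical
  set N := 3 * a + 3 * b with hN
  -- the type-restricted support, made opaque
  obtain ⟨Φ, hΦ⟩ : ∃ Φ : Finset ((Fin N → Fin 3) × (Fin N → Fin 3) × (Fin N → Fin 3)),
      Φ = univ.filter fun φ =>
        (∀ t, (φ.1 t : ℕ) + φ.2.1 t + φ.2.2 t = 2) ∧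
        (letterCount φ.1 0 = a + 2 * b ∧ letterCount φ.1 1 = 2 * a ∧ letterCount φ.1 2 = b) ∧
        (letterCount φ.2.1 0 = a + 2 * b ∧ letterCount φ.2.1 1 = 2 * a ∧ letterCount φ.2.1 2 = b) ∧
        (letterCount φ.2.2 0 = a + 2 * b ∧ letterCount φ.2.2 1 = 2 * a ∧ letterCount φ.2.2 2 = b) :=
    ⟨_, rfl⟩
  have hmem : ∀ φ, φ ∈ Φ ↔
      (∀ t, (φ.1 t : ℕ) + φ.2.1 t + φ.2.2 t = 2) ∧
        (letterCount φ.1 0 = a + 2 * b ∧ letterCount φ.1 1 = 2 * a ∧ letterCount φ.1 2 = b) ∧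
        (letterCount φ.2.1 0 = a + 2 * b ∧ letterCount φ.2.1 1 = 2 * a ∧ letterCount φ.2.1 2 = b) ∧
        (letterCount φ.2.2 0 = a + 2 * b ∧ letterCount φ.2.2 1 = 2 * a ∧ letterCount φ.2.2 2 = b) := by
    intro φ; rw [hΦ, mem_filter]; simp only [mem_univ, true_and]
  -- pattern counts on `Φ`, in the three cyclic coordinate systems
  have hpatI : ∀ φ ∈ Φ, levelPairCount φ.1 φ.2.1 1 1 = a ∧ levelPairCount φ.1 φ.2.1 0 1 = a ∧
      levelPairCount φ.1 φ.2.1 1 0 = a ∧ levelPairCount φ.1 φ.2.1 0 0 = b := by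
    intro φ hφ
    obtain ⟨hs, ⟨h10, h11, -⟩, ⟨h20, h21, h22⟩, ⟨-, -, h32⟩⟩ := (hmem φ).1 hφ
    obtain ⟨e1, e2, e3, e4, -⟩ := laserPatternCounts φ.1 φ.2.1 φ.2.2 hs h10 h11 h20 h21 h22 h32
    exact ⟨e1, e2, e3, e4⟩
  have hpatJ : ∀ φ ∈ Φ, levelPairCount φ.2.1 φ.2.2 1 1 = a ∧ levelPairCount φ.2.1 φ.2.2 0 1 = a ∧
      levelPairCount φ.2.1 φ.2.2 0 0 = b := by
    intro φ hφ
    obtain ⟨hs, ⟨-, -, h12⟩, ⟨h20, h21, -⟩, ⟨h30, h31, h32⟩⟩ := (hmem φ).1 hφ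
    obtain ⟨e1, e2, -, e4, -⟩ := laserPatternCounts φ.2.1 φ.2.2 φ.1
      (fun t => by have := hs t; omega) h20 h21 h30 h31 h32 h12
    exact ⟨e1, e2, e4⟩
  have hpatL : ∀ φ ∈ Φ, levelPairCount φ.2.2 φ.1 1 1 = a ∧ levelPairCount φ.2.2 φ.1 0 1 = a ∧
      levelPairCount φ.2.2 φ.1 0 0 = b := by
    intro φ hφ
    obtain ⟨hs, ⟨h10, h11, h12⟩, ⟨-, -, h22⟩, ⟨h30, h31, -⟩⟩ := (hmem φ).1 hφ
    obtain ⟨e1, e2, -, e4, -⟩ := laserPatternCounts φ.2.2 φ.1 φ.2.1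
      (fun t => by have := hs t; omega) h30 h31 h10 h11 h12 h22
    exact ⟨e1, e2, e4⟩
  -- the fibre bound `f`, made opaque
  obtain ⟨f, hf⟩ : ∃ f : ℕ, f = (2 * a).choose a * ((a + 2 * b).choose a * (2 * b).choose b) :=
    ⟨_, rfl⟩
  have hf1 : 1 ≤ f := by
    rw [hf]
    exact Nat.mul_pos (Nat.choose_pos (by omega))
      (Nat.mul_pos (Nat.choose_pos (by omega)) (Nat.choose_pos (by omega)))
  have hfval : ∀ P₀ : Fin N → Fin 3, letterCount P₀ 0 = a + 2 * b → letterCount P₀ 1 = 2 * a →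
      (letterCount P₀ 1).choose a * ((letterCount P₀ 0).choose a * (letterCount P₀ 0 - a).choose b) = f := by
    intro P₀ h0 h1
    rw [h0, h1, hf, show a + 2 * b - a = 2 * b by omega]
  -- fibres over the first coordinate
  have hfI : ∀ I₀, (Φ.filter fun φ => φ.1 = I₀).card ≤ f := by
    intro I₀
    rcases (Φ.filter fun φ => φ.1 = I₀).eq_empty_or_nonempty with he | ⟨φ₀, hφ₀⟩
    · rw [he, card_empty]; exact Nat.zero_le _
    obtain ⟨hφ₀Φ, hφ₀I⟩ := mem_filter.1 hφ₀
    obtain ⟨-, ⟨hI0, hI1, -⟩, -⟩ := (hmem φ₀).1 hφ₀Φ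
    rw [hφ₀I] at hI0 hI1
    rw [← hfval I₀ hI0 hI1, ← card_image_of_injOn (f := fun φ => φ.2) (fun φ hφ φ' hφ' h => by
      have e1 := (mem_filter.1 (mem_coe.1 hφ)).2; have e2 := (mem_filter.1 (mem_coe.1 hφ')).2
      exact Prod.ext (e1.trans e2.symm) h)]
    refine card_filter_fibre_le I₀ a b _ fun s hs => ?_
    obtain ⟨φ, hφ, rfl⟩ := mem_image.1 hs
    obtain ⟨hφΦ, hφI⟩ := mem_filter.1 hφ
    subst hφI
    obtain ⟨e1, e2, -, e4⟩ := hpatI φ hφΦ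
    exact ⟨((hmem φ).1 hφΦ).1, e1, e2, e4⟩
  -- fibres over the second coordinate (coordinates `(J, L, I)`)
  have hfJ : ∀ J₀, (Φ.filter fun φ => φ.2.1 = J₀).card ≤ f := by
    intro J₀
    rcases (Φ.filter fun φ => φ.2.1 = J₀).eq_empty_or_nonempty with he | ⟨φ₀, hφ₀⟩
    · rw [he, card_empty]; exact Nat.zero_le _
    obtain ⟨hφ₀Φ, hφ₀J⟩ := mem_filter.1 hφ₀
    obtain ⟨-, -, ⟨hJ0, hJ1, -⟩, -⟩ := (hmem φ₀).1 hφ₀Φ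
    rw [hφ₀J] at hJ0 hJ1
    rw [← hfval J₀ hJ0 hJ1, ← card_image_of_injOn (f := fun φ => (φ.2.2, φ.1))
      (fun φ hφ φ' hφ' h => by
        have e1 := (mem_filter.1 (mem_coe.1 hφ)).2; have e2 := (mem_filter.1 (mem_coe.1 hφ')).2
        simp only [Prod.mk.injEq] at h
        exact Prod.ext h.2 (Prod.ext (e1.trans e2.symm) h.1))]
    refine card_filter_fibre_le J₀ a b _ fun s hs => ?_
    obtain ⟨φ, hφ, rfl⟩ := mem_image.1 hs
    obtain ⟨hφΦ, hφJ⟩ := mem_filter.1 hφ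
    subst hφJ
    obtain ⟨e1, e2, e4⟩ := hpatJ φ hφΦ
    exact ⟨fun t => by have := ((hmem φ).1 hφΦ).1 t; simp only; omega, e1, e2, e4⟩
  -- fibres over the third coordinate (coordinates `(L, I, J)`)
  have hfL : ∀ L₀, (Φ.filter fun φ => φ.2.2 = L₀).card ≤ f := by
    intro L₀
    rcases (Φ.filter fun φ => φ.2.2 = L₀).eq_empty_or_nonempty with he | ⟨φ₀, hφ₀⟩
    · rw [he, card_empty]; exact Nat.zero_le _
    obtain ⟨hφ₀Φ, hφ₀L⟩ := mem_filter.1 hφ₀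
    obtain ⟨-, -, -, ⟨hL0, hL1, -⟩⟩ := (hmem φ₀).1 hφ₀Φ
    rw [hφ₀L] at hL0 hL1
    rw [← hfval L₀ hL0 hL1, ← card_image_of_injOn (f := fun φ => (φ.1, φ.2.1))
      (fun φ hφ φ' hφ' h => by
        have e1 := (mem_filter.1 (mem_coe.1 hφ)).2; have e2 := (mem_filter.1 (mem_coe.1 hφ')).2
        simp only [Prod.mk.injEq] at h
        exact Prod.ext h.1 (Prod.ext h.2 (e1.trans e2.symm)))]
    refine card_filter_fibre_le L₀ a b _ fun s hs => ?_
    obtain ⟨φ, hφ, rfl⟩ := mem_image.1 hs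
    obtain ⟨hφΦ, hφL⟩ := mem_filter.1 hφ
    subst hφL
    obtain ⟨e1, e2, e4⟩ := hpatL φ hφΦ
    exact ⟨fun t => by have := ((hmem φ).1 hφΦ).1 t; simp only; omega, e1, e2, e4⟩
  -- tightness maps
  let ind : (Fin N → Fin 3) → Fin N → ℤ := fun P t => ((P t : ℕ) : ℤ)
  let ind' : (Fin N → Fin 3) → Fin N → ℤ := fun P t => ((P t : ℕ) : ℤ) - 2
  have hind_inj : Function.Injective ind := by
    intro P P' h; funext t; have := congrFun h t; simp only [ind, Nat.cast_inj] at this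
    exact Fin.ext this
  have hind'_inj : Function.Injective ind' := by
    intro P P' h; funext t; have := congrFun h t; simp only [ind', sub_left_inj, Nat.cast_inj] at this
    exact Fin.ext this
  have hind_bd : ∀ P t, |ind P t| ≤ 2 := by
    intro P t
    have := (P t).2
    simp only [ind]
    rw [abs_of_nonneg (by positivity)]
    exact_mod_cast (by omega : (P t : ℕ) ≤ 2)
  have htight : ∀ φ ∈ Φ, ∀ t, ind φ.1 t + ind φ.2.1 t + ind' φ.2.2 t = 0 := by
    intro φ hφ t
    have := ((hmem φ).1 hφ).1 t
    simp only [ind, ind']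
    omega
  -- a Bertrand prime `6f < M ≤ 12f`
  obtain ⟨M, hMp, hM1, hM2⟩ := Nat.exists_prime_lt_and_le_two_mul (6 * f) (by omega)
  haveI : NeZero M := ⟨hMp.ne_zero⟩
  have hM4 : 2 * 2 < M := by omega
  have hM3 : 2 * (M / 2) ≤ M := Nat.mul_div_le M 2
  have hfM : 3 * f ≤ M / 2 := by omega
  have hM12 : M ≤ 12 * f := by omega
  -- the Salem–Spencer diagonal with `k = M / 2`
  obtain ⟨D₁, D₂, D₃, hD₁, hD₂, hD₃, hDcard⟩ := exists_zeroSum_diagonal M (M / 2) hM3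
  -- the hashing theorem
  obtain ⟨Δ, hΔΦ, hfree, hsize⟩ := BCS1997_thm1539_free Φ (r := N) (b := 2) ind ind ind' hind_inj
    hind_inj hind'_inj hind_bd hind_bd htight hfI hfJ hfL hMp hM4 D₁ D₂ D₃ hD₁ hD₂ hD₃
  refine ⟨Δ, fun δ hδ => ((hmem δ).1 (hΔΦ hδ)).1, fun δ hδ => ?_,
    fun δ hδ => ((hmem δ).1 (hΔΦ hδ)).2, ?_, ?_⟩
  · obtain ⟨e1, e2, e3, -⟩ := hpatI δ (hΔΦ hδ)
    exact ⟨e1, e2, e3⟩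
  · -- freeness in pointwise form
    intro δ hδ δ' hδ' δ'' hδ'' hs
    refine hfree δ hδ δ' hδ' δ'' hδ'' ((hmem _).2 ⟨hs, ?_, ?_, ?_⟩)
    · exact ((hmem δ).1 (hΔΦ hδ)).2.1
    · exact ((hmem δ').1 (hΔΦ hδ')).2.2.1
    · exact ((hmem δ'').1 (hΔΦ hδ'')).2.2.2
  · -- the size bound, from `|Φ| |D| (M - 3f) ≤ M³ |Δ|` with `6f < M ≤ 12 f` and `|Φ| ≥ binom · f`
    have hΦcard : Nat.multinomial univ ![a + 2 * b, 2 * a, b] * f ≤ Φ.card := by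
      rw [hf, ← multinomial_six_eq]
      exact le_card_laserSupport a b hN Φ fun φ h1 h2 h3 h4 => (hmem φ).2 ⟨h1, h2, h3, h4⟩
    obtain ⟨D, hD⟩ : ∃ D : Finset (ZMod M × ZMod M × ZMod M),
        D = (D₁ ×ˢ D₂ ×ˢ D₃).filter fun d => d.1 + d.2.1 + d.2.2 = 0 := ⟨_, rfl⟩
    rw [← hD] at hsize hDcard
    have hroth : rothNumberNat (3 * f) ≤ D.card := (rothNumberNat.mono hfM).trans hDcard
    have hM0 : (0 : ℤ) < M := by exact_mod_cast hMp.pos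
    have hf0 : (0 : ℤ) < f := by exact_mod_cast hf1
    have hΦD : (0 : ℤ) ≤ (Φ.card : ℤ) * D.card := mul_nonneg (Nat.cast_nonneg _) (Nat.cast_nonneg _)
    have hM6 : (6 * f : ℤ) < M := by exact_mod_cast hM1
    set C := Nat.multinomial univ ![a + 2 * b, 2 * a, b] with hC
    have h1 : (Φ.card : ℤ) * D.card * M ≤ 2 * (M : ℤ) ^ 3 * Δ.card :=
      calc (Φ.card : ℤ) * D.card * M ≤ (Φ.card : ℤ) * D.card * (2 * ((M : ℤ) - 3 * f)) :=
            mul_le_mul_of_nonneg_left (by linarith only [hM6]) hΦD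
        _ = 2 * ((Φ.card : ℤ) * D.card * ((M : ℤ) - 3 * f)) := by ring
        _ ≤ 2 * ((M : ℤ) ^ 3 * Δ.card) := mul_le_mul_of_nonneg_left hsize (by norm_num)
        _ = 2 * (M : ℤ) ^ 3 * Δ.card := by ring
    have h2 : (Φ.card : ℤ) * D.card ≤ 2 * (M : ℤ) ^ 2 * Δ.card := by
      refine le_of_mul_le_mul_right ?_ hM0
      calc (Φ.card : ℤ) * D.card * M ≤ 2 * (M : ℤ) ^ 3 * Δ.card := h1
        _ = 2 * (M : ℤ) ^ 2 * Δ.card * M := by ring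
    have hMsq : (M : ℤ) ^ 2 ≤ (12 * f : ℤ) ^ 2 :=
      pow_le_pow_left₀ hM0.le (by exact_mod_cast hM12) 2
    have h3 : (C : ℤ) * f * rothNumberNat (3 * f) ≤ 2 * (12 * (f : ℤ)) ^ 2 * Δ.card :=
      calc (C : ℤ) * f * rothNumberNat (3 * f) ≤ (Φ.card : ℤ) * D.card := by
            have := Nat.mul_le_mul hΦcard hroth
            exact_mod_cast this
        _ ≤ 2 * (M : ℤ) ^ 2 * Δ.card := h2
        _ ≤ 2 * (12 * (f : ℤ)) ^ 2 * Δ.card :=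
            mul_le_mul_of_nonneg_right (mul_le_mul_of_nonneg_left hMsq (by norm_num))
              (Nat.cast_nonneg _)
    have h4 : (C : ℤ) * rothNumberNat (3 * f) ≤ 288 * (f : ℤ) * Δ.card := by
      refine le_of_mul_le_mul_right ?_ hf0
      calc (C : ℤ) * rothNumberNat (3 * f) * f = (C : ℤ) * f * rothNumberNat (3 * f) := by ring
        _ ≤ 2 * (12 * (f : ℤ)) ^ 2 * Δ.card := h3
        _ = 288 * (f : ℤ) * Δ.card * f := by ring
    rw [← hf]
    exact_mod_cast h4

end AutomaticDesignBelowFourFifths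

end Summit.MatrixMultiplication.MatrixMultiplication.Theorems

end
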